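import Summits.BirchSwinnertonDyer.BirchSwinnertonDyer.Theorems.ResidualThetaTransportAtTwoThetaLayerLambdaCongruenceAtTwoRescaledPlusLine
import HarnessLib

/-!
# Crux `ThetaLayerLambdaCongruenceAtTwo` (stmt-BirchSwinnertonDyer-20688, route ResidualThetaTransportAtTwo), line
# `birth`: INJECTIVITY OF `S₀`-DEPLETION in characteristic `0` — the partner's depleted plus symbol is not identically
# zero as soon as no reciprocal root of an Euler factor `P_{g,v}` is `ℓ_v`·(root of unity) (width seat
# bsd-wall-rtt-p3-w3 g2; `--supports stmt-BirchSwinnertonDyer-20688 --as helper`; closes nothing)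

HONEST FRAMING. THEOREMS ONLY (pure algebra of finite sums + one instantiation); nothing about any curve or form is
asserted; BSD is not proved by any of this.

WHAT. The companion `…RescaledPlusLine` derives the crux from (C3) + (μ-W₁) + (NZ-g) «`φ^{S₀}_{g,Ω} ≢ 0`». Here (NZ-g)
is reduced to a statement about the partner's HECKE EIGENVALUES alone:
  (NR) for every `v ∈ S₀` and every root of unity `ζ ∈ ℚ̄₂`, `P_{g,v}(ζ/ℓ_v) ≠ 0`,
where `P_{g,v}(X) = 1 − ι a_{ℓ_v}(g) X + 𝟙_{ℓ_v ∤ M} ℓ_v X²` is the Euler polynomial of the crux — i.e. no reciprocal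
root of `P_{g,v}` is `ℓ_v` times a root of unity, which is the Ramanujan–Petersson bound `|α| = √ℓ` at good `ℓ`
(Eichler–Shimura–Igusa–Weil / Deligne) and `a_ℓ ∈ {0, ±1}` at `ℓ ∣ M` (Atkin–Lehner–Li), both IN PRINT for weight-`2`
newforms. MECHANISM (§1–§3, any algebraically closed field `K`, any `1`-periodic `ψ : ℚ → K`): the depletion
operator is the action of `∏_v D_v`, `D_v = ∑_{k<3} c_{v,k}[ℓ_v^k]` (w2's monoid-algebra formalism
`…DepletedHeckeAlgebra`), and each single factor `ψ ↦ ψ + b[ℓ]ψ + c[ℓ²]ψ` is INJECTIVE on `1`-periodic functions when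
no root `γ` of `1 + bγ + cγ²` is a root of unity: on rationals with denominator prime to `ℓ` the dilation `[ℓ]` is a
permutation of finite order `m = φ(d)`, and an `m`-periodic solution of the order-`≤ 2` recurrence
`u_i + b u_{i+1} + c u_{i+2} = 0` vanishes (factor the recurrence, geometric sequences on a cycle, `γ^m ≠ 1`); rationals
with `ℓ^e` in the denominator follow by induction on `e` (the relation expresses `ψ(r)` through `ψ(ℓr)`, `ψ(ℓ²r)`).
§4 instantiates: `φ^{S₀}_{g,Ω} ≡ 0 ⇒ [r]⁺_{g,Ω} ≡ 0`, contradicting Manin's trick (`exists_norm_plusSymbolK_eq_max`).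

References: [Deligne1974] Thm. 8.2; [AtkinLehner1970] Thm. 3; [GreenbergVatsal2000] §1 (8); [CremonaAlgorithms1997] §2.8.
-/

noncomputable section

-- justification: the `Summit.BirchSwinnertonDyer.BirchSwinnertonDyer.…` path repeats a component (route-file convention)
set_option linter.dupNamespace false

open scoped Classical

open Polynomial Literature.NumberTheory.EllipticCurves Literature.NumberTheory.EllipticCurves.ModularForms

namespace Summit.BirchSwinnertonDyer.BirchSwinnertonDyer.Theorems.ThetaLayerLambdaCongruenceAtTwo

/-! ## §1. Periodic solutions of linear recurrences of order `≤ 2` vanish off roots of unity -/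

section Cyclic

variable {K : Type*} [Field K]

/-- A geometric sequence: `w_{i+1} = γ w_i` for all `i` gives `w_{i+n} = γⁿ w_i`. [folklore] -/
theorem cyclicRec_geom {w : ℕ → K} {γ : K} (h : ∀ i, w (i + 1) = γ * w i) (i n : ℕ) :
    w (i + n) = γ ^ n * w i := by
  induction n with
  | zero => rw [add_zero, pow_zero, one_mul]
  | succ n ih => rw [← add_assoc, h, ih, pow_succ]; ring

/-- A geometric sequence that is `m`-periodic with ratio `γ`, `γ^m ≠ 1`, is zero. [folklore] -/
theorem cyclicRec_eq_zero_of_geom {w : ℕ → K} {γ : K} {m : ℕ} (h : ∀ i, w (i + 1) = γ * w i)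
    (hper : ∀ i, w (i + m) = w i) (hγ : γ ^ m ≠ 1) (i : ℕ) : w i = 0 := by
  have h1 : (γ ^ m - 1) * w i = 0 := by rw [sub_mul, one_mul, ← cyclicRec_geom h i m, hper, sub_self]
  exact (mul_eq_zero.mp h1).resolve_left (sub_ne_zero.mpr hγ)

/-- **An `m`-periodic solution of `u_i + b u_{i+1} + c u_{i+2} = 0` vanishes when no root `γ` of `1 + bγ + cγ²` has
`γ^m = 1`** (`K` algebraically closed: factor the recurrence into two geometric steps). [folklore] -/
theorem cyclicRec_eq_zero [IsAlgClosed K] {u : ℕ → K} {b c : K} {m : ℕ}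
    (hper : ∀ i, u (i + m) = u i) (hrec : ∀ i, u i + b * u (i + 1) + c * u (i + 2) = 0)
    (hNR : ∀ γ : K, 1 + b * γ + c * γ ^ 2 = 0 → γ ^ m ≠ 1) (i : ℕ) : u i = 0 := by
  by_cases hc : c = 0
  · by_cases hb : b = 0
    · have h := hrec i
      rwa [hb, hc, zero_mul, zero_mul, add_zero, add_zero] at h
    · -- order one: `u_{i+1} = -b⁻¹ u_i`
      have hγ : 1 + b * (-b⁻¹) + c * (-b⁻¹) ^ 2 = 0 := by
        rw [hc, zero_mul, add_zero, mul_neg, mul_inv_cancel₀ hb, add_neg_cancel]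
      refine cyclicRec_eq_zero_of_geom (γ := -b⁻¹) (fun j ↦ ?_) hper (hNR _ hγ) i
      have h := hrec j
      rw [hc, zero_mul, add_zero] at h
      have hbb : b⁻¹ * b = 1 := inv_mul_cancel₀ hb
      linear_combination b⁻¹ * h - u (j + 1) * hbb
  · -- order two: `1 + bγ + cγ² = c(γ - γ₁)(γ - γ₂)`
    obtain ⟨γ₁, hγ₁⟩ : ∃ γ : K, 1 + b * γ + c * γ ^ 2 = 0 := by
      obtain ⟨z, hz⟩ := IsAlgClosed.exists_root (C c * X ^ 2 + C b * X + C 1 : K[X])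
        (by rw [degree_quadratic hc]; exact two_ne_zero)
      refine ⟨z, ?_⟩
      have hz' : c * z ^ 2 + b * z + 1 = 0 := by
        simpa only [IsRoot.def, eval_add, eval_mul, eval_C, eval_pow, eval_X] using hz
      linear_combination hz'
    have hcc : c * c⁻¹ = 1 := mul_inv_cancel₀ hc
    set γ₂ : K := -(b * c⁻¹) - γ₁ with hγ₂def
    have hsum : c * (γ₁ + γ₂) = -b := by rw [hγ₂def]; linear_combination (-b) * hcc
    have hprod : c * (γ₁ * γ₂) = 1 := by rw [hγ₂def]; linear_combination (-(b * γ₁)) * hcc - hγ₁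
    have hγ₂ : 1 + b * γ₂ + c * γ₂ ^ 2 = 0 := by linear_combination γ₂ * hsum - hprod
    -- `w_j := u_{j+1} - γ₂ u_j` is geometric with ratio `γ₁`, hence zero
    have hw : ∀ j, u (j + 1 + 1) - γ₂ * u (j + 1) = γ₁ * (u (j + 1) - γ₂ * u j) := by
      intro j
      have h3 : c * ((u (j + 1 + 1) - γ₂ * u (j + 1)) - γ₁ * (u (j + 1) - γ₂ * u j)) = 0 := by
        linear_combination hrec j - u (j + 1) * hsum + u j * hprod
      exact sub_eq_zero.mp ((mul_eq_zero.mp h3).resolve_left hc)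
    have hwper : ∀ j, u (j + m + 1) - γ₂ * u (j + m) = u (j + 1) - γ₂ * u j := by
      intro j; rw [add_right_comm, hper, hper]
    have hw0 : ∀ j, u (j + 1) - γ₂ * u j = 0 :=
      cyclicRec_eq_zero_of_geom (w := fun j ↦ u (j + 1) - γ₂ * u j) hw hwper (hNR _ hγ₁)
    -- hence `u` is geometric with ratio `γ₂`, hence zero
    exact cyclicRec_eq_zero_of_geom (γ := γ₂) (fun j ↦ (sub_eq_zero.mp (hw0 j))) hper (hNR _ hγ₂) i

end Cyclic

/-! ## §2. A single depletion factor `ψ ↦ ψ + b[ℓ]ψ + c[ℓ²]ψ` is injective on `1`-periodic functions -/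

section Single

variable {K : Type*} [Field K] [IsAlgClosed K]

/-- **Injectivity of one depletion factor.** Let `ψ : ℚ → K` be `1`-periodic, `ℓ` a prime, `b, c ∈ K` such that no
root `γ` of `1 + bγ + cγ²` is a root of unity. If `ψ(x) + b ψ(ℓx) + c ψ(ℓ²x) = 0` for all `x`, then `ψ = 0`: on
`a/d` with `ℓ ∤ d` the sequence `i ↦ ψ(ℓ^i a/d)` is `φ(d)`-periodic (Euler) and solves the recurrence (§1); on
`a/(dℓ^e)` induct on `e`. [cite: GreenbergVatsal2000, §1 (8) (the depleted form; injectivity in characteristic 0)] -/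
theorem eq_zero_of_depletionFactor_eq_zero (ψ : ℚ → K) (hper : ∀ (x : ℚ) (k : ℤ), ψ (x + k) = ψ x)
    {ℓ : ℕ} (hℓ : ℓ.Prime) {b c : K} (hNR : ∀ γ : K, 1 + b * γ + c * γ ^ 2 = 0 → ∀ m : ℕ, 0 < m → γ ^ m ≠ 1)
    (hD : ∀ x : ℚ, ψ x + b * ψ ((ℓ : ℚ) * x) + c * ψ ((ℓ : ℚ) ^ 2 * x) = 0) (x : ℚ) : ψ x = 0 := by
  -- (A) denominators prime to `ℓ`
  have hA : ∀ d : ℕ, 0 < d → ℓ.Coprime d → ∀ a : ℤ, ψ ((a : ℚ) / d) = 0 := by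
    intro d hd hcop a
    have hm : 0 < Nat.totient d := Nat.totient_pos.mpr hd
    obtain ⟨t, ht⟩ : ∃ t : ℕ, ℓ ^ Nat.totient d = d * t + 1 := by
      have h1 : 1 ≤ ℓ ^ Nat.totient d := Nat.one_le_pow _ _ hℓ.pos
      obtain ⟨t, ht⟩ := (Nat.modEq_iff_dvd' h1).mp (Nat.ModEq.pow_totient hcop).symm
      exact ⟨t, by omega⟩
    have hd0 : (d : ℚ) ≠ 0 := by exact_mod_cast hd.ne'
    have hu : ∀ i, ψ ((ℓ : ℚ) ^ (i + Nat.totient d) * ((a : ℚ) / d)) = ψ ((ℓ : ℚ) ^ i * ((a : ℚ) / d)) := by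
      intro i
      have e : (ℓ : ℚ) ^ (i + Nat.totient d) * ((a : ℚ) / d) =
          (ℓ : ℚ) ^ i * ((a : ℚ) / d) + (((ℓ ^ i * t : ℕ) * a : ℤ) : ℚ) := by
        have hpow : ((ℓ : ℚ)) ^ Nat.totient d = d * t + 1 := by exact_mod_cast ht
        rw [pow_add, hpow]
        push_cast
        field_simp
        ring
      rw [e, hper]
    have h0 := cyclicRec_eq_zero (u := fun i ↦ ψ ((ℓ : ℚ) ^ i * ((a : ℚ) / d))) hu (fun i ↦ by
      have h := hD ((ℓ : ℚ) ^ i * ((a : ℚ) / d))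
      rwa [show (ℓ : ℚ) * ((ℓ : ℚ) ^ i * ((a : ℚ) / d)) = (ℓ : ℚ) ^ (i + 1) * ((a : ℚ) / d) by ring,
        show (ℓ : ℚ) ^ 2 * ((ℓ : ℚ) ^ i * ((a : ℚ) / d)) = (ℓ : ℚ) ^ (i + 2) * ((a : ℚ) / d) by ring] at h)
      (fun γ hγ ↦ hNR γ hγ _ hm) 0
    simpa only [pow_zero, one_mul] using h0
  -- (B) denominators `d ℓ^e`, induction on `e`
  have hB : ∀ (e d : ℕ), 0 < d → ℓ.Coprime d → ∀ a : ℤ, ψ ((a : ℚ) / (d * (ℓ : ℚ) ^ e)) = 0 := by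
    intro e
    induction e with
    | zero => intro d hd hcop a; rw [pow_zero, mul_one]; exact hA d hd hcop a
    | succ e ih =>
      intro d hd hcop a
      have hℓ0 : (ℓ : ℚ) ≠ 0 := by exact_mod_cast hℓ.ne_zero
      have hd0 : (d : ℚ) ≠ 0 := by exact_mod_cast hd.ne'
      have h := hD ((a : ℚ) / (d * (ℓ : ℚ) ^ (e + 1)))
      have e1 : (ℓ : ℚ) * ((a : ℚ) / (d * (ℓ : ℚ) ^ (e + 1))) = (a : ℚ) / (d * (ℓ : ℚ) ^ e) := by
        field_simp
        ring
      have e2 : (ℓ : ℚ) ^ 2 * ((a : ℚ) / (d * (ℓ : ℚ) ^ (e + 1))) = ((ℓ * a : ℤ) : ℚ) / (d * (ℓ : ℚ) ^ e) := by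
        push_cast
        field_simp
        ring
      rwa [e1, e2, ih d hd hcop a, ih d hd hcop (ℓ * a), mul_zero, mul_zero, add_zero, add_zero] at h
  -- every rational is `num/(d ℓ^e)` with `ℓ ∤ d`
  obtain ⟨e, d, hnd, hden⟩ := Nat.exists_eq_pow_mul_and_not_dvd x.den_nz ℓ hℓ.ne_one
  have hd : 0 < d := Nat.pos_of_ne_zero (by rintro rfl; exact x.den_nz (by rw [hden, mul_zero]))
  have hx : x = (x.num : ℚ) / (d * (ℓ : ℚ) ^ e) := by
    conv_lhs => rw [← Rat.num_div_den x, hden]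
    push_cast
    ring
  rw [hx]
  exact hB e d hd ((Nat.Prime.coprime_iff_not_dvd hℓ).mpr hnd) x.num

end Single

/-! ## §3. The product of depletion factors (monoid-algebra action, w2) is injective -/

section Product

variable {K : Type*} [Field K] [IsAlgClosed K]

omit [IsAlgClosed K] in
/-- The action of one depletion factor `∑_{k<3} single (q^k) (c_k)` on `Ψ` at `y` is
`c₀ Ψ(y) + c₁ Ψ(q y) + c₂ Ψ(q² y)`. [folklore] -/
theorem act_depletionFactor_apply (Ψ : ℚ → K) (q : ℕ) (cf : ℕ → K) (y : ℚ) :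
    (((∑ k ∈ Finset.range 3, MonoidAlgebra.single (q ^ k) (cf k) : MonoidAlgebra K ℕ)).coeff.sum
        fun m b ↦ b * Ψ ((m : ℚ) * y)) = cf 0 * Ψ y + cf 1 * Ψ ((q : ℚ) * y) + cf 2 * Ψ ((q : ℚ) ^ 2 * y) := by
  rw [act_sum, Finset.sum_range_succ, Finset.sum_range_succ, Finset.sum_range_one, act_single, act_single,
    act_single, pow_zero, pow_one, Nat.cast_one, one_mul, Nat.cast_pow]

/-- **Injectivity of the `S`-depletion operator on `1`-periodic functions** (characteristic `0`, `K` algebraically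
closed): if every `ℓ_v` (`v ∈ S`) is prime, every factor is normalised (`c_{v,0} = 1`) and no root of
`1 + c_{v,1}γ + c_{v,2}γ²` is a root of unity, then `(∏_{v∈S} D_v)·ψ ≡ 0` forces `ψ ≡ 0` (peel off one factor with
`act_mul`, §2, induction on `S`). [cite: GreenbergVatsal2000, §1 (8)] -/
theorem eq_zero_of_act_prod_depletionFactor_eq_zero (ψ : ℚ → K) (hper : ∀ (x : ℚ) (k : ℤ), ψ (x + k) = ψ x)
    {α : Type*} (S : Finset α) (ℓ : α → ℕ) (cf : α → ℕ → K) (hℓ : ∀ v ∈ S, (ℓ v).Prime)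
    (h0 : ∀ v ∈ S, cf v 0 = 1)
    (hNR : ∀ v ∈ S, ∀ γ : K, 1 + cf v 1 * γ + cf v 2 * γ ^ 2 = 0 → ∀ m : ℕ, 0 < m → γ ^ m ≠ 1)
    (hzero : ∀ x : ℚ, ((∏ v ∈ S, ∑ k ∈ Finset.range 3, MonoidAlgebra.single (ℓ v ^ k) (cf v k) :
      MonoidAlgebra K ℕ).coeff.sum fun m b ↦ b * ψ ((m : ℚ) * x)) = 0) (x : ℚ) : ψ x = 0 := by
  classical
  induction S using Finset.induction_on generalizing x with
  | empty =>
    have h := hzero x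
    simp only [Finset.prod_empty, MonoidAlgebra.one_def, act_single, Nat.cast_one, one_mul] at h
    exact h
  | insert v T hv ih =>
    -- the inner function `Ψ = (∏_T D)·ψ` is periodic and killed by the factor at `v`
    have hΨ : ∀ y : ℚ, ((∏ w ∈ T, ∑ k ∈ Finset.range 3, MonoidAlgebra.single (ℓ w ^ k) (cf w k) :
        MonoidAlgebra K ℕ).coeff.sum fun m b ↦ b * ψ ((m : ℚ) * y)) = 0 := by
      refine eq_zero_of_depletionFactor_eq_zero
        (fun y ↦ ((∏ w ∈ T, ∑ k ∈ Finset.range 3, MonoidAlgebra.single (ℓ w ^ k) (cf w k) :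
          MonoidAlgebra K ℕ).coeff.sum fun m b ↦ b * ψ ((m : ℚ) * y)))
        (fun y k ↦ act_periodic ψ hper _ y k) (hℓ v (Finset.mem_insert_self v T))
        (hNR v (Finset.mem_insert_self v T)) (fun y ↦ ?_)
      have h := hzero y
      rw [Finset.prod_insert hv, act_mul] at h
      have h' : (((∑ k ∈ Finset.range 3, MonoidAlgebra.single (ℓ v ^ k) (cf v k) : MonoidAlgebra K ℕ)).coeff.sum
          fun m b ↦ b * (fun y ↦ ((∏ w ∈ T, ∑ k ∈ Finset.range 3, MonoidAlgebra.single (ℓ w ^ k) (cf w k) :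
            MonoidAlgebra K ℕ).coeff.sum fun m b ↦ b * ψ ((m : ℚ) * y))) ((m : ℚ) * y)) = 0 := h
      rw [act_depletionFactor_apply (fun y ↦ ((∏ w ∈ T, ∑ k ∈ Finset.range 3,
          MonoidAlgebra.single (ℓ w ^ k) (cf w k) : MonoidAlgebra K ℕ).coeff.sum fun m b ↦ b * ψ ((m : ℚ) * y)))
        (ℓ v) (cf v) y, h0 v (Finset.mem_insert_self v T), one_mul] at h'
      exact h'
    exact ih (fun w hw ↦ hℓ w (Finset.mem_insert_of_mem hw)) (fun w hw ↦ h0 w (Finset.mem_insert_of_mem hw))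
      (fun w hw ↦ hNR w (Finset.mem_insert_of_mem hw)) hΨ x

end Product


/-! ## §4. The partner's depleted plus symbol is not identically zero, from (NR) -/

section Partner

variable {M : ℕ} [NeZero M] {g : CuspForm (CongruenceSubgroup.Gamma0 M) 2}
  (ι : coeffField g →+* PadicAlgCl 2) (Ω : ℂ)
  (S₀ : Finset (IsDedekindDomain.HeightOneSpectrum (NumberField.RingOfIntegers ℚ)))

omit [NeZero M] in
/-- Evaluating the Euler polynomial `P = 1 − C a·X + C e·X²` (resp. `1 − C a·X`): with `c_k = P.coeff k · q⁻ᵏ`,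
`P(γ/q) = 1 + c₁ γ + c₂ γ²` and `c₀ = 1`. [folklore] -/
theorem eval_partnerEulerPolynomial_mul_inv (v : IsDedekindDomain.HeightOneSpectrum (NumberField.RingOfIntegers ℚ))
    (γ : PadicAlgCl 2) :
    Polynomial.eval (γ * ((Rat.HeightOneSpectrum.natGenerator v : PadicAlgCl 2))⁻¹) (1 - Polynomial.C (embCoeff g ι (Rat.HeightOneSpectrum.natGenerator v)) * Polynomial.X + (if Rat.HeightOneSpectrum.natGenerator v ∣ M then 0 else Polynomial.C (Rat.HeightOneSpectrum.natGenerator v : PadicAlgCl 2)) * Polynomial.X ^ 2 : Polynomial (PadicAlgCl 2)) =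
      1 + ((1 - Polynomial.C (embCoeff g ι (Rat.HeightOneSpectrum.natGenerator v)) * Polynomial.X + (if Rat.HeightOneSpectrum.natGenerator v ∣ M then 0 else Polynomial.C (Rat.HeightOneSpectrum.natGenerator v : PadicAlgCl 2)) * Polynomial.X ^ 2 : Polynomial (PadicAlgCl 2)).coeff 1 * (((Rat.HeightOneSpectrum.natGenerator v : PadicAlgCl 2))⁻¹) ^ 1) * γ +
        ((1 - Polynomial.C (embCoeff g ι (Rat.HeightOneSpectrum.natGenerator v)) * Polynomial.X + (if Rat.HeightOneSpectrum.natGenerator v ∣ M then 0 else Polynomial.C (Rat.HeightOneSpectrum.natGenerator v : PadicAlgCl 2)) * Polynomial.X ^ 2 : Polynomial (PadicAlgCl 2)).coeff 2 * (((Rat.HeightOneSpectrum.natGenerator v : PadicAlgCl 2))⁻¹) ^ 2) * γ ^ 2 ∧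
    (1 - Polynomial.C (embCoeff g ι (Rat.HeightOneSpectrum.natGenerator v)) * Polynomial.X + (if Rat.HeightOneSpectrum.natGenerator v ∣ M then 0 else Polynomial.C (Rat.HeightOneSpectrum.natGenerator v : PadicAlgCl 2)) * Polynomial.X ^ 2 : Polynomial (PadicAlgCl 2)).coeff 0 * (((Rat.HeightOneSpectrum.natGenerator v : PadicAlgCl 2))⁻¹) ^ 0 = 1 := by
  split_ifs with h
  · simp only [zero_mul, add_zero, eval_sub, eval_one, eval_mul, eval_C, eval_X, coeff_sub, coeff_one, coeff_C_mul,
      coeff_X, pow_zero, mul_one]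
    norm_num
    ring
  · simp only [eval_add, eval_sub, eval_one, eval_mul, eval_C, eval_X, eval_pow, coeff_add, coeff_sub, coeff_one,
      coeff_C_mul, coeff_X, coeff_X_pow, pow_zero, mul_one]
    norm_num
    ring

/-- **(NZ-g) from (NR).** For a newform `g`, any plus period `Ω`, any embedding `ι` and any finite set `S₀` of places:
if for every `v ∈ S₀` no root of unity `ζ ∈ ℚ̄₂` satisfies `P_{g,v}(ζ/ℓ_v) = 0` (no reciprocal root of the Euler
factor is `ℓ_v`·(root of unity) — Ramanujan–Petersson at `ℓ_v`), then the `S₀`-depleted plus symbol `φ^{S₀}_{g,Ω}` is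
NOT identically zero on `ℚ` (§3 + a non-zero plus symbol from Manin's trick).
[cite: Deligne1974, Thm. 8.2 (the input, as a hypothesis); GreenbergVatsal2000, §1 (8)] -/
theorem exists_depletedPartnerSymbol_ne_zero_of_nonRoot (hg : IsNewform0 g) (hΩ : IsPlusPeriod g Ω)
    (hNR : ∀ v ∈ S₀, ∀ ζ : PadicAlgCl 2, (∃ m : ℕ, 0 < m ∧ ζ ^ m = 1) →
      Polynomial.eval (ζ * ((Rat.HeightOneSpectrum.natGenerator v : PadicAlgCl 2))⁻¹) (1 - Polynomial.C (embCoeff g ι (Rat.HeightOneSpectrum.natGenerator v)) * Polynomial.X + (if Rat.HeightOneSpectrum.natGenerator v ∣ M then 0 else Polynomial.C (Rat.HeightOneSpectrum.natGenerator v : PadicAlgCl 2)) * Polynomial.X ^ 2 : Polynomial (PadicAlgCl 2)) ≠ 0) :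
    ∃ r : ℚ, (∑ k ∈ Fintype.piFinset (fun _ : S₀ ↦ Finset.range 3), (∏ v : S₀, (1 - Polynomial.C (embCoeff g ι (Rat.HeightOneSpectrum.natGenerator (v : IsDedekindDomain.HeightOneSpectrum (NumberField.RingOfIntegers ℚ)))) * Polynomial.X + (if Rat.HeightOneSpectrum.natGenerator (v : IsDedekindDomain.HeightOneSpectrum (NumberField.RingOfIntegers ℚ)) ∣ M then 0 else Polynomial.C (Rat.HeightOneSpectrum.natGenerator (v : IsDedekindDomain.HeightOneSpectrum (NumberField.RingOfIntegers ℚ)) : PadicAlgCl 2)) * Polynomial.X ^ 2 : Polynomial (PadicAlgCl 2)).coeff (k v) * ((Rat.HeightOneSpectrum.natGenerator (v : IsDedekindDomain.HeightOneSpectrum (NumberField.RingOfIntegers ℚ)) : PadicAlgCl 2)⁻¹) ^ (k v)) * ι (plusSymbolK g Ω (r * ((∏ v : S₀, Rat.HeightOneSpectrum.natGenerator (v : IsDedekindDomain.HeightOneSpectrum (NumberField.RingOfIntegers ℚ)) ^ (k v) : ℕ) : ℚ)))) ≠ 0 := by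
  by_contra hall
  push Not at hall
  obtain ⟨B, r₀, hB, -, hr₀⟩ := CohomologicalPeriod.exists_norm_plusSymbolK_eq_max hg ι hΩ
  have hne : ι (plusSymbolK g Ω r₀) ≠ 0 := by
    intro h
    rw [h, norm_zero] at hr₀
    exact hB.ne hr₀
  refine hne (eq_zero_of_act_prod_depletionFactor_eq_zero (fun y ↦ ι (plusSymbolK g Ω y))
    (fun y k ↦ by simp only [plusSymbolK_add_intCast]) S₀ (fun v ↦ Rat.HeightOneSpectrum.natGenerator v)
    (fun v k ↦ (1 - Polynomial.C (embCoeff g ι (Rat.HeightOneSpectrum.natGenerator v)) * Polynomial.X + (if Rat.HeightOneSpectrum.natGenerator v ∣ M then 0 else Polynomial.C (Rat.HeightOneSpectrum.natGenerator v : PadicAlgCl 2)) * Polynomial.X ^ 2 : Polynomial (PadicAlgCl 2)).coeff k * (((Rat.HeightOneSpectrum.natGenerator v : PadicAlgCl 2))⁻¹) ^ k)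
    (fun v _ ↦ Rat.HeightOneSpectrum.prime_natGenerator v)
    (fun v _ ↦ (eval_partnerEulerPolynomial_mul_inv ι v 0).2)
    (fun v hv γ hγ m hm heq ↦ hNR v hv γ ⟨m, hm, heq⟩ ?_) (fun x ↦ ?_) r₀)
  · rw [(eval_partnerEulerPolynomial_mul_inv ι v γ).1]
    exact hγ
  · rw [act_prod_depletionFactor_eq_sum_piFinset (fun y ↦ ι (plusSymbolK g Ω y)) S₀
      (fun v ↦ Rat.HeightOneSpectrum.natGenerator v)
      (fun v k ↦ (1 - Polynomial.C (embCoeff g ι (Rat.HeightOneSpectrum.natGenerator v)) * Polynomial.X + (if Rat.HeightOneSpectrum.natGenerator v ∣ M then 0 else Polynomial.C (Rat.HeightOneSpectrum.natGenerator v : PadicAlgCl 2)) * Polynomial.X ^ 2 : Polynomial (PadicAlgCl 2)).coeff k * (((Rat.HeightOneSpectrum.natGenerator v : PadicAlgCl 2))⁻¹) ^ k) x]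
    simpa only using hall x

end Partner


/-! ## §5. THE CRUX BY NAME from (C3) + (μ-W₁) + (NR-g) -/

section Glue

open scoped MatrixGroups

/-- **THE CRUX `ThetaLayerLambdaCongruenceAtTwo` BY NAME from (C3) + (μ-W₁) + (NR-g)** — the partner `g`
enters the research residue of line `birth` only through the RAMANUJAN–PETERSSON NON-DEGENERACY of its Euler factors:
  (NR-g) for every newform `g` on `Γ₀(M)`, every embedding `ι : K_g → ℚ̄₂`, every prime `ℓ` and every root of unity
  `ζ ∈ ℚ̄₂`: `P_{g,ℓ}(ζ/ℓ) ≠ 0`, `P_{g,ℓ}(X) = 1 − ι a_ℓ(g) X + 𝟙_{ℓ∤M} ℓ X²`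
(no reciprocal root of the Euler factor is `ℓ`·(root of unity): `|α| = √ℓ` for `ℓ ∤ M` — Deligne, Weil I, Thm. 8.2,
for weight `2` Eichler–Shimura–Igusa; `a_ℓ ∈ {0, ±1}` for `ℓ ∣ M` — Atkin–Lehner 1970, Thm. 3; IN PRINT, taken here
as a hypothesis), together with the lead's plus-line stub (C3) and the curve-side (μ-W₁). Composition:
`exists_depletedPartnerSymbol_ne_zero_of_nonRoot` (§4) feeds (NZ-g) of
`thetaLayerLambdaCongruenceAtTwo_of_plusLine_curveMax_nonvanishing` (`…RescaledPlusLine`).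
[cite: Deligne1974, Thm. 8.2; AtkinLehner1970, Thm. 3; GreenbergVatsal2000, §1 (10) (shape; the inputs are hypotheses)] -/
theorem thetaLayerLambdaCongruenceAtTwo_of_plusLine_curveMax_nonRoot
    (hC3 : ∀ (W : WeierstrassCurve ℚ) [W.IsElliptic] [W.IsGloballyMinimal], Literature.NumberTheory.EllipticCurves.Rank1Residual.GoodSS W 2 → W.Δ < 0 → ∀ (N' : ℕ), Odd N' → (∀ ℓ : ℕ, ℓ.Prime → ℓ ∣ W.conductorNorm ℤ → ℓ ∣ N') → ∀ (Φ₁ Φ₂ : ℚ → PadicAlgCl 2), (∀ (r : ℚ) (z : ℤ), Φ₁ (r + z) = Φ₁ r) → (∀ r : ℚ, Φ₁ (-r) = Φ₁ r) → (∀ (γ : CongruenceSubgroup.Gamma0 (N')) (r : ℚ), ((γ : SL(2, ℤ)) 1 0 : ℚ) * r + ((γ : SL(2, ℤ)) 1 1 : ℚ) ≠ 0 → Φ₁ ((((γ : SL(2, ℤ)) 0 0 : ℚ) * r + ((γ : SL(2, ℤ)) 0 1 : ℚ)) / (((γ : SL(2, ℤ)) 1 0 : ℚ) * r + ((γ : SL(2,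 ℤ)) 1 1 : ℚ))) = (if ((γ : SL(2, ℤ)) 1 0) = 0 then 0 else Φ₁ ((((γ : SL(2, ℤ)) 0 0 : ℚ)) / (((γ : SL(2, ℤ)) 1 0 : ℚ)))) + Φ₁ r) → (∀ (r : ℚ) (z : ℤ), Φ₂ (r + z) = Φ₂ r) → (∀ r : ℚ, Φ₂ (-r) = Φ₂ r) → (∀ (γ : CongruenceSubgroup.Gamma0 (N')) (r : ℚ), ((γ : SL(2, ℤ)) 1 0 : ℚ) * r + ((γ : SL(2, ℤ)) 1 1 : ℚ) ≠ 0 → Φ₂ ((((γ : SL(2, ℤ)) 0 0 : ℚ) * r + ((γ : SL(2, ℤ)) 0 1 : ℚ)) / (((γ : SL(2, ℤ)) 1 0 : ℚ) * r + ((γ : SL(2, ℤ)) 1 1 : ℚ))) = (if ((γ : SL(2, ℤ)) 1 0) = 0 then 0 else Φ₂ ((((γ : SL(2, ℤ)) 0 0 : ℚ)) / (((γ : SL(2, ℤ)) 1 0 : ℚ)))) + Φ₂ r) → (∀ r : ℚ, ‖Φ₁ r‖ ≤ 1) → (∀ r : ℚ, ‖Φ₂ r‖ ≤ 1) → (∃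 r : ℚ, ‖Φ₁ r‖ = 1) → (∃ r : ℚ, ‖Φ₂ r‖ = 1) → (∀ q : ℕ, q.Prime → ¬ q ∣ N' → ∀ r : ℚ, ‖(∑ j : Fin q, Φ₁ ((r + j) / q)) + Φ₁ (q * r) - (W.LFunction q : PadicAlgCl 2) * Φ₁ r‖ < 1) → (∀ q : ℕ, q.Prime → ¬ q ∣ N' → ∀ r : ℚ, ‖(∑ j : Fin q, Φ₂ ((r + j) / q)) + Φ₂ (q * r) - (W.LFunction q : PadicAlgCl 2) * Φ₂ r‖ < 1) → (∀ ℓ : ℕ, ℓ.Prime → ℓ ∣ N' → ∀ r : ℚ, ‖∑ j : Fin ℓ, Φ₁ ((r + j) / ℓ)‖ < 1) → (∀ ℓ : ℕ, ℓ.Prime → ℓ ∣ N' → ∀ r : ℚ, ‖∑ j : Fin ℓ, Φ₂ ((r + j) / ℓ)‖ < 1) → ∃ a : PadicAlgCl 2, ∀ r : ℚ, ‖a * Φ₁ r - Φ₂ r‖ < 1)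
    (hμW : ∀ (W : WeierstrassCurve ℚ) [W.IsElliptic] [W.IsGloballyMinimal], ¬ W.HasCM → W.analyticRank = 0 → Literature.NumberTheory.EllipticCurves.Rank1Residual.GoodSS W 2 → W.frobeniusTrace 2 = 0 → W.Δ < 0 → ∀ [NeZero (W.conductorNorm ℤ)] (f : CuspForm (CongruenceSubgroup.Gamma0 (W.conductorNorm ℤ)) 2), Literature.NumberTheory.EllipticCurves.ModularForms.IsNewformOf W f → ∀ (S₀ : Finset (IsDedekindDomain.HeightOneSpectrum (NumberField.RingOfIntegers ℚ))), (∀ v ∈ S₀, ((2 : ℕ) : NumberField.RingOfIntegers ℚ) ∉ v.asIdeal) → (∀ v : IsDedekindDomain.HeightOneSpectrum (NumberField.RingOfIntegers ℚ), ¬ W.HasGoodReductionAt v → v ∈ S₀) → ∃ n₁ : ℕ, Even n₁ ∧ ∃ s : ZMod (2 ^ n₁), ∀ r : ℚ, ‖(∑ k ∈ Fintype.piFinset (fun _ : S₀ ↦ Finset.range 3), (∏ v : S₀, ((W.localPolynomialAt (v : IsDedekindDomain.HeightOneSpectrum (NumberField.RingOfIntegers ℚ))).map (Int.castRingHom (PadicAlgCl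 2))).coeff (k v) * ((Rat.HeightOneSpectrum.natGenerator (v : IsDedekindDomain.HeightOneSpectrum (NumberField.RingOfIntegers ℚ)) : PadicAlgCl 2)⁻¹) ^ (k v)) * algebraMap ℚ (PadicAlgCl 2) (ratPlusSymbol f (r * ((∏ v : S₀, Rat.HeightOneSpectrum.natGenerator (v : IsDedekindDomain.HeightOneSpectrum (NumberField.RingOfIntegers ℚ)) ^ (k v) : ℕ) : ℚ))))‖ ≤ ‖(∑ k ∈ Fintype.piFinset (fun _ : S₀ ↦ Finset.range 3), (∏ v : S₀, ((W.localPolynomialAt (v : IsDedekindDomain.HeightOneSpectrum (NumberField.RingOfIntegers ℚ))).map (Int.castRingHom (PadicAlgCl 2))).coeff (k v) * ((Rat.HeightOneSpectrum.natGenerator (v : IsDedekindDomain.HeightOneSpectrum (NumberField.RingOfIntegers ℚ)) : PadicAlgCl 2)⁻¹) ^ (k v)) * algebraMap ℚ (PadicAlgCl 2) (ratPlusSymbol f ((((((Literature.NumberTheory.EllipticCurves.cyclotomicGenerator 2 : ZMod (2 ^ (n₁ + 2))) ^ s.val).val : ℚ) / (2 : ℚ) ^ (n₁ + 2))) * ((∏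 v : S₀, Rat.HeightOneSpectrum.natGenerator (v : IsDedekindDomain.HeightOneSpectrum (NumberField.RingOfIntegers ℚ)) ^ (k v) : ℕ) : ℚ))))‖)
    (hNR : ∀ (M : ℕ) [NeZero M] (g : CuspForm (CongruenceSubgroup.Gamma0 M) 2)
      (ι : Literature.NumberTheory.EllipticCurves.ModularForms.coeffField g →+* PadicAlgCl 2),
      Literature.NumberTheory.EllipticCurves.ModularForms.IsNewform0 g → ∀ ℓ : ℕ, ℓ.Prime → ∀ ζ : PadicAlgCl 2,
      (∃ m : ℕ, 0 < m ∧ ζ ^ m = 1) →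
        Polynomial.eval (ζ * ((ℓ : PadicAlgCl 2))⁻¹) (1 - Polynomial.C (embCoeff g ι ℓ) * Polynomial.X +
          (if ℓ ∣ M then 0 else Polynomial.C (ℓ : PadicAlgCl 2)) * Polynomial.X ^ 2 : Polynomial (PadicAlgCl 2)) ≠ 0) :
    Summit.BirchSwinnertonDyer.BirchSwinnertonDyer.Theses.ResidualThetaTransportAtTwo.ThetaLayerLambdaCongruenceAtTwo :=
  thetaLayerLambdaCongruenceAtTwo_of_plusLine_curveMax_nonvanishing hC3 hμW
    (fun _W _ _ _ _ _ _ _ M _ g ι Ω _ hnew _ _ hΩ _ _ _ _ S₀ _ _ _ ↦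
      exists_depletedPartnerSymbol_ne_zero_of_nonRoot ι Ω S₀ hnew hΩ
        (fun v _ ζ hζ ↦ hNR M g ι hnew _ (Rat.HeightOneSpectrum.prime_natGenerator v) ζ hζ))

end Glue

end Summit.BirchSwinnertonDyer.BirchSwinnertonDyer.Theorems.ThetaLayerLambdaCongruenceAtTwo

end
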